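import Mathlib
import Summits.MatrixMultiplication.MatrixMultiplication.Theorems.FidelityWitnessesFidelityThesisSepMajorantSingleProduct

/-!
# Line `separable-majorant` for crux `FidelityWitnesses.FidelityThesis` (stmt-MatrixMultiplication-4956) —
stub `stub_frameConditioningLaw`: the FRAME CONDITIONING LAW

Conventions (tree `matMulTensor`): slots `a = (κ,ν)` (output), `b = (κ,μ)`, `c = (μ',ν)` in `Fin n × Fin n`,
`⟨n,n,n⟩(a,b,c) = [a.1 = b.1 ∧ b.2 = c.1 ∧ a.2 = c.2]`, output slices `T_a := ⟨n,n,n⟩(a,·,·)`.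

Statement.  Let `S = Σ_{l<r} w_l ⊗ u_l ⊗ v_l` and `N_l := ‖u_l‖² ‖v_l‖² = ‖u_l ⊗ v_l‖²`.  If the input frame
`x_l = u_l ⊗ v_l` has normalised Gram matrix `≥ A` (`A ≥ 0`), i.e. `A · Σ_l |d_l|² N_l ≤ ‖Σ_l d_l x_l‖²` for
all coefficients `d`, then `A · |⟨S, ⟨n,n,n⟩⟩|² ≤ r · ‖S‖²` (the flattening witness with `n` replaced by `1/A`).

Proof (weighted Cauchy–Schwarz, no square roots).  Slice by slice, `⟨S, ⟨n,n,n⟩⟩ = Σ_a Σ_l w_l(a) t_l(a)` with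
`t_l(a) = (U_l V_l)_a = ⟨u_l ⊗ v_l, T_a⟩` (`sepMajorant_frame_pairing`).  Termwise
`(|w_l(a)| |t_l(a)|)² ≤ (|w_l(a)|² N_l) · (|t_l(a)|² / N_l)` (equality if `N_l ≠ 0`; if `N_l = 0` then `t_l(a) = 0`
by `sepMajorant_product_slice_eq_zero`), so two nested applications of
`Finset.sum_sq_le_sum_mul_sum_of_sq_le_mul` give
`|⟨S,⟨n,n,n⟩⟩|² ≤ (Σ_{a,l} |w_l(a)|² N_l) · (Σ_{a,l} |t_l(a)|² / N_l)`.  The frame hypothesis at `d = w_·(a)`,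
summed over `a`, bounds `A ·` the first factor by `‖S‖²`; the single-product law
(`sepMajorant_singleProductLaw`: `Σ_a |t_l(a)|² ≤ N_l`) bounds the second by `Σ_l 1 = r`.
Idea card `Cruxes/FidelityThesis/Ideas/separable-majorant-law.md`, § Why it bites (2).  Supports item
`stmt-MatrixMultiplication-4956`; no definitions.
-/

namespace Summit.MatrixMultiplication.MatrixMultiplication.Theorems

open scoped BigOperators ComplexConjugate
open Literature.Computability.AlgebraicComplexity

/-- **Frame conditioning law.**  If the `r` input products `u_l ⊗ v_l` of `S = Σ_l w_l ⊗ u_l ⊗ v_l` form a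
frame whose normalised Gram matrix is `≥ A` (`A · Σ_l |d_l|² ‖u_l‖²‖v_l‖² ≤ ‖Σ_l d_l u_l ⊗ v_l‖²` for all `d`,
with `A ≥ 0`), then `A · |⟨S, ⟨n,n,n⟩⟩|² ≤ r · ‖S‖²`: an `A`-well-conditioned frame of `r` products captures at
most `r/A` of the `n³` units of `⟨n,n,n⟩`, for every `n`.  (Weighted Cauchy–Schwarz over `(a, l)` with weights
`N_l = ‖u_l‖²‖v_l‖²`, the frame hypothesis on each output slice, and the single-product law.) [folklore] -/
theorem stub_frameConditioningLaw {n r : ℕ} (w u v : Fin r → Fin n × Fin n → ℂ) (A : ℝ) (hA : 0 ≤ A)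
    (hframe : ∀ d : Fin r → ℂ,
      A * ∑ l, ‖d l‖ ^ 2 * ((∑ b, ‖u l b‖ ^ 2) * ∑ c, ‖v l c‖ ^ 2) ≤
        ∑ b, ∑ c, ‖∑ l, d l * u l b * v l c‖ ^ 2) :
    A * ‖∑ a, ∑ b, ∑ c, (∑ l, w l a * u l b * v l c) * matMulTensor ℂ n n n a b c‖ ^ 2 ≤
      (r : ℝ) * ∑ a, ∑ b, ∑ c, ‖∑ l, w l a * u l b * v l c‖ ^ 2 := by
  -- the matrix-product entries `t l a = (U_l V_l)_a` and the product weights `N l = ‖u_l‖² ‖v_l‖²`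
  obtain ⟨t, ht⟩ : ∃ t : Fin r → Fin n × Fin n → ℂ,
      ∀ l a, t l a = ∑ m : Fin n, u l (a.1, m) * v l (m, a.2) := ⟨_, fun _ _ => rfl⟩
  obtain ⟨N, hN⟩ : ∃ N : Fin r → ℝ, ∀ l, N l = (∑ b, ‖u l b‖ ^ 2) * ∑ c, ‖v l c‖ ^ 2 :=
    ⟨_, fun _ => rfl⟩
  have hN0 : ∀ l, 0 ≤ N l := fun l => by rw [hN]; positivity
  -- (i) single-product law in matrix form: `Σ_a |t_l(a)|² ≤ N_l`
  have hsingle : ∀ l, ∑ a, ‖t l a‖ ^ 2 ≤ N l := fun l => by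
    have h := sepMajorant_singleProductLaw (u l) (v l)
    simp_rw [sepMajorant_product_slice] at h
    simp_rw [ht, hN]
    exact h
  -- (ii) degenerate products: `N_l = 0 ⇒ t_l = 0`
  have htzero : ∀ l a, N l = 0 → t l a = 0 := fun l a h => by
    rw [ht, ← sepMajorant_product_slice (u l) (v l) a]
    exact sepMajorant_product_slice_eq_zero (u l) (v l) ((hN l).symm.trans h) a
  -- (iii) termwise Cauchy–Schwarz condition `(|w| |t|)² ≤ (|w|² N) (|t|² / N)`
  have hterm : ∀ l a, (‖w l a‖ * ‖t l a‖) ^ 2 ≤ ‖w l a‖ ^ 2 * N l * (‖t l a‖ ^ 2 / N l) := by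
    intro l a
    rcases eq_or_ne (N l) 0 with h0 | h0
    · simp [htzero l a h0]
    · refine le_of_eq ?_
      field_simp
  -- (iv) weighted Cauchy–Schwarz over `l` (each output slot), then over `a`
  have hinner : ∀ a, (∑ l, ‖w l a‖ * ‖t l a‖) ^ 2 ≤
      (∑ l, ‖w l a‖ ^ 2 * N l) * ∑ l, ‖t l a‖ ^ 2 / N l := fun a =>
    Finset.sum_sq_le_sum_mul_sum_of_sq_le_mul Finset.univ
      (fun l _ => mul_nonneg (sq_nonneg _) (hN0 l)) (fun l _ => div_nonneg (sq_nonneg _) (hN0 l))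
      (fun l _ => hterm l a)
  have houter : (∑ a, ∑ l, ‖w l a‖ * ‖t l a‖) ^ 2 ≤
      (∑ a, ∑ l, ‖w l a‖ ^ 2 * N l) * ∑ a, ∑ l, ‖t l a‖ ^ 2 / N l :=
    Finset.sum_sq_le_sum_mul_sum_of_sq_le_mul Finset.univ
      (fun a _ => Finset.sum_nonneg fun l _ => mul_nonneg (sq_nonneg _) (hN0 l))
      (fun a _ => Finset.sum_nonneg fun l _ => div_nonneg (sq_nonneg _) (hN0 l))
      (fun a _ => hinner a)
  -- (v) the frame hypothesis on each output slice, summed over `a`: `A Σ_{a,l} |w_l(a)|² N_l ≤ ‖S‖²`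
  have hF : A * ∑ a, ∑ l, ‖w l a‖ ^ 2 * N l ≤ ∑ a, ∑ b, ∑ c, ‖∑ l, w l a * u l b * v l c‖ ^ 2 := by
    rw [Finset.mul_sum]
    refine Finset.sum_le_sum fun a _ => ?_
    simp only [hN]
    exact hframe fun l => w l a
  -- (vi) the single-product law summed over `l`: `Σ_{a,l} |t_l(a)|² / N_l ≤ r`
  have hG : ∑ a, ∑ l, ‖t l a‖ ^ 2 / N l ≤ (r : ℝ) := by
    rw [Finset.sum_comm]
    calc ∑ l, ∑ a, ‖t l a‖ ^ 2 / N l = ∑ l, (∑ a, ‖t l a‖ ^ 2) / N l := by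
          simp_rw [Finset.sum_div]
      _ ≤ ∑ _l : Fin r, (1 : ℝ) :=
          Finset.sum_le_sum fun l _ => div_le_one_of_le₀ (hsingle l) (hN0 l)
      _ = r := by simp
  -- (vii) assemble
  have hpair : (∑ a, ∑ b, ∑ c, (∑ l, w l a * u l b * v l c) * matMulTensor ℂ n n n a b c) =
      ∑ a, ∑ l, w l a * t l a := by
    rw [sepMajorant_frame_pairing]
    simp only [ht]
  have hnorm : ‖∑ a, ∑ l, w l a * t l a‖ ≤ ∑ a, ∑ l, ‖w l a‖ * ‖t l a‖ :=
    calc ‖∑ a, ∑ l, w l a * t l a‖ ≤ ∑ a, ‖∑ l, w l a * t l a‖ := norm_sum_le _ _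
      _ ≤ ∑ a, ∑ l, ‖w l a * t l a‖ := Finset.sum_le_sum fun a _ => norm_sum_le _ _
      _ = ∑ a, ∑ l, ‖w l a‖ * ‖t l a‖ := by simp_rw [norm_mul]
  have hG0 : 0 ≤ ∑ a, ∑ l, ‖t l a‖ ^ 2 / N l :=
    Finset.sum_nonneg fun a _ => Finset.sum_nonneg fun l _ => div_nonneg (sq_nonneg _) (hN0 l)
  have hS0 : 0 ≤ ∑ a, ∑ b, ∑ c, ‖∑ l, w l a * u l b * v l c‖ ^ 2 :=
    Finset.sum_nonneg fun a _ => Finset.sum_nonneg fun b _ => Finset.sum_nonneg fun c _ => sq_nonneg _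
  calc A * ‖∑ a, ∑ b, ∑ c, (∑ l, w l a * u l b * v l c) * matMulTensor ℂ n n n a b c‖ ^ 2
      = A * ‖∑ a, ∑ l, w l a * t l a‖ ^ 2 := by rw [hpair]
    _ ≤ A * (∑ a, ∑ l, ‖w l a‖ * ‖t l a‖) ^ 2 :=
        mul_le_mul_of_nonneg_left (pow_le_pow_left₀ (norm_nonneg _) hnorm 2) hA
    _ ≤ A * ((∑ a, ∑ l, ‖w l a‖ ^ 2 * N l) * ∑ a, ∑ l, ‖t l a‖ ^ 2 / N l) :=
        mul_le_mul_of_nonneg_left houter hA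
    _ = (A * ∑ a, ∑ l, ‖w l a‖ ^ 2 * N l) * ∑ a, ∑ l, ‖t l a‖ ^ 2 / N l := by ring
    _ ≤ (∑ a, ∑ b, ∑ c, ‖∑ l, w l a * u l b * v l c‖ ^ 2) * ∑ a, ∑ l, ‖t l a‖ ^ 2 / N l :=
        mul_le_mul_of_nonneg_right hF hG0
    _ ≤ (∑ a, ∑ b, ∑ c, ‖∑ l, w l a * u l b * v l c‖ ^ 2) * r :=
        mul_le_mul_of_nonneg_left hG hS0
    _ = (r : ℝ) * ∑ a, ∑ b, ∑ c, ‖∑ l, w l a * u l b * v l c‖ ^ 2 := mul_comm _ _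

end Summit.MatrixMultiplication.MatrixMultiplication.Theorems
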